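import Summits.QuantumFields.BalabanUV.Beta.D1BFx.GhostCurrentRealised
import Summits.QuantumFields.BalabanUV.Beta.D1BFx.ColourlessAntisymmetry

/-!
# `BalabanUV.Beta.D1BFx.MainTable` — road «BF-x» for binder row D1, slot (SPLIT) ∕ leaf A1.ii, part 5e: THE MAIN TERM AT A BASE SITE — the weighted
# sum of the gluon model-vector bubble and the ghost kinetic bubble over the frozen even leg IS `lam·bfKernel (Gf) N` = `lam·stK/(w_μw_ν)` EXACTLY WHEN the
# weights stand in the loop-weight ratio of record `ω_gl·cE² : ω_gh·cK² = 1 : −2` (displayed as a hypothesis — the CHECK-N0/(K) consistency test, assumed nowhere)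

HONEST DEPENDENCY (page 1, mandatory): continuum YM on T⁴ ⇐ BetaPertH ∧ nine spine estimates (0/9 proved); BetaPertH ⇐ (D1) ∧ (D4) ∧
CAP+tail; G-an2-4 gates asym, D1 and NE2/3/4.  HONEST FRAMING (cell contract, verbatim): «discharging `BetaPertH` makes Bałaban's UV
stability UNCONDITIONAL — a real constructive-QFT result; it is NOT the continuum limit and NOT the Clay problem.»  THIS MODULE DISCHARGES
NOTHING of the wall: [folklore] `ring` bookkeeping BY NAME over parts 4a (`ModelTablesRealised.bubble_vecStn_frozen`, `stK_of_bfKernel`), 4b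
(`ColourlessAntisymmetry.SbE_split` — the E-sector's model block IS `vecK`), 5a (`GhostCurrentRealised.bubble_ghCur_ghCur_frozen`) and an3's `SpinTable.bfKernel` ∕
`PlaquetteWeitzenbock.sTot`; ONE definition with a body ([our object] `vecK`, a NAME for the realised colourless model-vector list; asserts nothing).  No `Prop`
minted, nothing printed asserted, 0 sorry.  0 wall binders; NOT D1, NOT `BetaPertH`, NOT continuum, NOT Clay.

ABSOLUTE RULE (cell charter, verbatim): «No internally-minted statement may enter as a cited fact. Every hypothesis is either kernel-proved in
this package or a verbatim quotation of a PUBLISHED theorem with page reference. The manuscript(s) under audit are NOT citable for their own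
disputed steps — they are the thing under adjudication; programme-internal (2001/route/tribunal) claims are never citable.»

WHY (`HOME/b2b-balaban-beta-d1-p2/SPLIT-SPEC.md` v1 §3, sub-leaf (5e)).  Node A0's term list isolates, at the base site, MAIN-gl := `−½·cE²·bubble A_b (VEC μ ·) (VEC ν ·)`
and MAIN-gh := `−½·cK²·bubble B_b (KIN μ ·) (KIN ν ·)` over the frozen legs `A_b`, `B_b` (`δ_{ab}·g (y − x)`, `g = Gf n b` even); slot (K) supplies the piece weights
`ω_gl`, `ω_gh` (loop weights of record × colour trace × normalisation).  THIS FILE computes the weighted sum in closed form (`main_table`) and shows that it is a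
multiple of an3's realised kernel `bfKernel g N` (hence of `stK`, `stK_of_bfKernel`) PRECISELY under the ratio `ω_gh·cK² = −2·(ω_gl·cE²)`: with the common
normalisation named by `ω_gl·cE² = 2·N²·lam`, MAIN `= lam·bfKernel g N u_μ u_ν v` (`main_table_eq_bfKernel`).
* §1 [our object] `vecK κ u := realK u u (reixStn ιU (vecStn sTot κ 1))`; `SbE_eq_vecK_add` (part 4b's split in this name).
* §2 **`main_table`**: `g` even, `μ ≠ ν`: `ω_gl·(−½·(cE²·bubble A (vecK μ u) (vecK ν (u+(v+u_μ))))) + ω_gh·(−½·(cK²·bubble B (ghCur μ u) (ghCur ν (u+(v+u_μ)))))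
  = −½·(ω_gl·cE²·(8·cellForm g − 8·D_{μν}(g²)) + ω_gh·cK²·(2·cellForm g))` (at `v`).
* §3 **`main_table_eq_bfKernel`**: under `hω : ω_gh·cK² = −2·(ω_gl·cE²)` and `hlam : ω_gl·cE² = 2·N²·lam`: MAIN `= lam·bfKernel g N u_μ u_ν v`;
  **`main_table_eq_stK`**: the same times `v_μ·v_ν` is `lam·stK μ ν N g v`.
Unit `b2b-balaban-beta-d1-p2` (road owner, gen 2); `LEAVES-BFx.md` row A1.ii (part 5e).
-/

open Finset
open scoped BigOperators
open Literature.MathematicalPhysics.QuantumFieldTheory.Balaban1983to89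
open Literature.MathematicalPhysics.QuantumFieldTheory.Balaban1983to89.Beta
open ExpKernelCalculus (Site MKer bubble)
open DyadicShell (Pt toReal)
open BubbleTransfer (unitVec)
open GradedBubbles (smulS)
open GhostTable (cellForm mixedDiffFun)
open SpinTable (bfKernel)
open SquareTable (stK)
open PlaquetteWeitzenbock (sTot sTot_sq)
open Summit.QuantumFields.BalabanUV.Beta.WilsonStencilZ4 (vecStn divStn remStn)
open Summit.QuantumFields.BalabanUV.Beta.D1BFx.GluonKernelSectors (SbE)
open Summit.QuantumFields.BalabanUV.Beta.D1BFx.StencilRealisation (realK)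
open Summit.QuantumFields.BalabanUV.Beta.D1BFx.WilsonStencilRealised (trStn reixStn ιU)
open Summit.QuantumFields.BalabanUV.Beta.D1BFx.ModelTablesRealised (bubble_vecStn_frozen stK_of_bfKernel)
open Summit.QuantumFields.BalabanUV.Beta.D1BFx.ColourlessAntisymmetry (SbE_split)
open Summit.QuantumFields.BalabanUV.Beta.D1BFx.GhostStencil (ghCur)
open Summit.QuantumFields.BalabanUV.Beta.D1BFx.GhostCurrentRealised (bubble_ghCur_ghCur_frozen)

namespace Summit.QuantumFields.BalabanUV.Beta.D1BFx.MainTable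

/-! ## §1 The realised colourless model-vector stencil -/

/-- [our object] **THE MODEL-VECTOR FINE STENCIL** at the fine bond `(κ, u)`: the kernel realisation, at the base site `u`, of an3's colourless model vector list
at the Wilson action's derived spin coupling, direction-reindexed: `vecK κ u := realK u u (reixStn ιU (vecStn sTot κ 1))`.  A DEFINITION (a name); asserts nothing. -/
noncomputable def vecK (κ : Fin 4) (u : Pt) : MKer 4 (Fin 4) := realK u u (reixStn ιU (vecStn sTot κ (1 : Matrix Unit Unit ℝ)))

/-- [our object] Unfolding. -/
theorem vecK_eq (κ : Fin 4) (u : Pt) : vecK κ u = realK u u (reixStn ιU (vecStn sTot κ (1 : Matrix Unit Unit ℝ))) := rfl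

/-- [folklore] **THE E-SECTOR SPLIT IN THIS NAME** (part 4b): `SbE κ u = vecK κ u + DIVₐ + REMₐ`. -/
theorem SbE_eq_vecK_add (κ : Fin 4) (u : Pt) :
    SbE κ u = vecK κ u
      + (1 / 2 : ℝ) • (realK u u (reixStn ιU (smulS 2 (divStn κ (1 : Matrix Unit Unit ℝ))))
          - realK u u (trStn (reixStn ιU (smulS 2 (divStn κ (1 : Matrix Unit Unit ℝ))))))
      + (1 / 2 : ℝ) • (realK u u (reixStn ιU (remStn κ (1 : Matrix Unit Unit ℝ)))
          - realK u u (trStn (reixStn ιU (remStn κ (1 : Matrix Unit Unit ℝ))))) :=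
  SbE_split κ u

/-! ## §2 The weighted MAIN combination in closed form -/

section Main

variable (g : Pt → ℝ)

/-- [folklore] **THE MAIN TERM IN CLOSED FORM.**  `g` even, `μ ≠ ν`, frozen legs `A` (fibre `Fin 4`) and `B` (fibre `Unit`) of shape `δ_{ab}·g (y − x)`, first vertex at the
base site `u`, second at `u + (v + u_μ)`; gluon weight `ω_gl`, Wilson weight `cE`, ghost weight `ω_gh`, ghost kinetic weight `cK`:
`ω_gl·(−½·(cE²·bubble A (vecK μ u) (vecK ν ·))) + ω_gh·(−½·(cK²·bubble B (ghCur μ u) (ghCur ν ·))) = −½·(ω_gl·cE²·(8·cellForm g − 8·D_{μν}(g²)) + ω_gh·cK²·(2·cellForm g))`. -/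
theorem main_table (hg : ∀ w, g (-w) = g w) {A : MKer 4 (Fin 4)} (hA : ∀ x y a b, A x y a b = if a = b then g (y - x) else 0)
    {B : MKer 4 Unit} (hB : ∀ x y a b, B x y a b = if a = b then g (y - x) else 0) {μ ν : Fin 4} (hμν : μ ≠ ν) (ωgl ωgh cE cK : ℝ) (u v : Pt) :
    ωgl * (-(1 / 2 : ℝ) * (cE ^ 2 * bubble A (vecK μ u) (vecK ν (u + (v + unitVec μ)))))
      + ωgh * (-(1 / 2 : ℝ) * (cK ^ 2 * bubble B (ghCur μ u) (ghCur ν (u + (v + unitVec μ))))) =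
      -(1 / 2 : ℝ) * (ωgl * cE ^ 2 * (8 * cellForm g (unitVec μ) (unitVec ν) v - 8 * mixedDiffFun (fun w => g w ^ 2) (unitVec μ) (unitVec ν) v)
        + ωgh * cK ^ 2 * (2 * cellForm g (unitVec μ) (unitVec ν) v)) := by
  rw [vecK_eq, vecK_eq, bubble_vecStn_frozen g hg hA hμν sTot u v, bubble_ghCur_ghCur_frozen g hg hB μ ν u v, sTot_sq]
  ring

/-- [folklore] **MAIN IS A MULTIPLE OF an3's REALISED KERNEL EXACTLY UNDER THE LOOP-WEIGHT RATIO OF RECORD.**  If the ghost and gluon weights stand in the ratio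
`ω_gh·cK² = −2·(ω_gl·cE²)` (FP ghost −2 : gluon +1, K-R1-SPEC §2) and `ω_gl·cE² = 2·N²·lam` names the common normalisation, then
MAIN `= lam · bfKernel g N u_μ u_ν v` (`bfKernel g N = 8N²·D_{μν}(g²) − 4N²·cellForm g`). -/
theorem main_table_eq_bfKernel (hg : ∀ w, g (-w) = g w) {A : MKer 4 (Fin 4)} (hA : ∀ x y a b, A x y a b = if a = b then g (y - x) else 0)
    {B : MKer 4 Unit} (hB : ∀ x y a b, B x y a b = if a = b then g (y - x) else 0) {μ ν : Fin 4} (hμν : μ ≠ ν) {ωgl ωgh cE cK N lam : ℝ}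
    (hω : ωgh * cK ^ 2 = -2 * (ωgl * cE ^ 2)) (hlam : ωgl * cE ^ 2 = 2 * N ^ 2 * lam) (u v : Pt) :
    ωgl * (-(1 / 2 : ℝ) * (cE ^ 2 * bubble A (vecK μ u) (vecK ν (u + (v + unitVec μ)))))
      + ωgh * (-(1 / 2 : ℝ) * (cK ^ 2 * bubble B (ghCur μ u) (ghCur ν (u + (v + unitVec μ))))) =
      lam * bfKernel g N (unitVec μ) (unitVec ν) v := by
  rw [main_table g hg hA hB hμν, bfKernel]
  have h1 : ωgh * cK ^ 2 * (2 * cellForm g (unitVec μ) (unitVec ν) v) = -2 * (ωgl * cE ^ 2) * (2 * cellForm g (unitVec μ) (unitVec ν) v) := by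
    rw [hω]
  rw [h1, hlam]
  ring

/-- [folklore] **… AND WITH THE (1.22) WEIGHT IT IS `lam·stK`**: `v_μ·v_ν·MAIN = lam·stK μ ν N g v` (`SquareTable.stK_eq_closedForm`). -/
theorem main_table_eq_stK (hg : ∀ w, g (-w) = g w) {A : MKer 4 (Fin 4)} (hA : ∀ x y a b, A x y a b = if a = b then g (y - x) else 0)
    {B : MKer 4 Unit} (hB : ∀ x y a b, B x y a b = if a = b then g (y - x) else 0) {μ ν : Fin 4} (hμν : μ ≠ ν) {ωgl ωgh cE cK N lam : ℝ}
    (hω : ωgh * cK ^ 2 = -2 * (ωgl * cE ^ 2)) (hlam : ωgl * cE ^ 2 = 2 * N ^ 2 * lam) (u v : Pt) :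
    toReal v μ * toReal v ν *
      (ωgl * (-(1 / 2 : ℝ) * (cE ^ 2 * bubble A (vecK μ u) (vecK ν (u + (v + unitVec μ)))))
        + ωgh * (-(1 / 2 : ℝ) * (cK ^ 2 * bubble B (ghCur μ u) (ghCur ν (u + (v + unitVec μ)))))) =
      lam * stK μ ν N g v := by
  rw [main_table_eq_bfKernel g hg hA hB hμν hω hlam, stK_of_bfKernel]
  ring

end Main

end Summit.QuantumFields.BalabanUV.Beta.D1BFx.MainTable
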